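import Literature.Claims.NS.Ri2025

/-!
# C08 `Ri2025` — kernel refutation of the AVERAGING BOUND of §3 Step 2 and of its displayed support

Text of record: Myong-Hwan Ri, arXiv:2508.19590 **v1** (2025-08-27), typed skeleton
`Literature.Claims.NS.Ri2025` (p465548, commit d84bac2ebc4c; locators `l.N` = lines of the pinned
`.clean.tex`, print pp.12–13 per ns-claims-ref-3).

The paper's explicit sequences are (2.2) `a` (sparse weight, `a(j) = log₂ j` on the windows
`|j − 2^{2^k}| ≤ k`, `k ≥ 1`, else `1`), (3.2) `b(j) = 2^{−j−1} Σ_{i=1}^{j} 2^i a(i)` and (4.3)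
`j₀(k) = ⌈log₂ k⌉ + 1`.  Witness family: `q ≥ 1`, the window centre `L = 2^{2^q}` and `n = 2^{L−2}`.
For `2^{L−3} < k ≤ 2^{L−2}` one has `j₀(2k) = L` (and `j₀(2k+1) = L` for `2^{L−3} ≤ k < 2^{L−2}`), while
`b(L) ≥ a(L)/2 = 2^{q−1}` (the top term of (3.2) alone).  Hence HALF of the indices `k ≤ n` sit at the single
window level `L`, and

  `Σ_{k=1}^{n} b(j₀(2k)) ≥ windowSum n ≥ 2^{L−3} · 2^{q−1} = 2^{q−2} · n`   (likewise for `2k+1`),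

which is unbounded relative to `n` as `q → ∞`.  This refutes, in the kernel:

* `not_StepAvg` — THE AVERAGING BOUND as printed, l.830–839 (print p.13): "`Σ_{k=1}^{n} b(j₀(2k)) ≤ 3n`,
  `Σ_{k=1}^{n} b(j₀(2k+1)) ≤ 3n`, `∀ n ≥ n₀`" (`Literature.Claims.NS.Ri2025.StepAvg`, the statement consumed
  at (2.26n)/(4.13)); `not_StepAvgC` — its «generic constant» reading (`∃ C`, referee R#b);
  `not_StepAvgOdd` — the odd half "in the same way" (l.834–839);
* the companion file `SoloRefuteRi2025LevelCount` refutes, by the same family, the window bound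
  `Step_avgWindow` (l.817–829) and THE LEVEL-COUNT INEQUALITY `Step_avgLevelCount(Ev)` (l.817–821) — the FIRST
  failing step of the display, of which `StepAvg` is the downstream consumer
  (`Literature.Claims.NS.Ri2025.windowBound_of_support`, `stepAvg_of_support`).

All theorems are closed terms over Mathlib's `ℕ`/`ℝ` (`Nat.clog`, `Real.logb`, `Finset` sums); axioms
`propext`, `Classical.choice`, `Quot.sound`.  Refuter: ns-claims-refuter-5 (scaffold `RiScaffold.lean`,
2026-08-26T17:27Z, def texts adopted verbatim by the skeleton under TYPING-HYGIENE item 13); filed under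
interim convention (b) by the paired salvage prover.

WHAT THIS IS NOT: not a claim about NS regularity or blow-up; not a claim about any author beyond the typed
locator.
-/

-- The summit's canonical theorem namespace repeats the summit name (single-conjunct summit).
set_option linter.dupNamespace false

noncomputable section
open Finset
open Literature.Claims.NS.Ri2025

namespace Summit.NavierStokesRegularity.NavierStokesRegularity.Theorems.Ri2025

/-! ### Elementary facts -/

/-- `a(j) ≥ 0` for `j ≥ 1` ((2.2): `log₂ j ≥ 0` or `1`). [cite: Ri2025, (2.2) l.307–315 (print p.5)] -/
theorem a_nonneg {j : ℤ} (hj : 1 ≤ j) : 0 ≤ a j := by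
  unfold a
  split_ifs
  · exact Real.logb_nonneg (by norm_num) (by exact_mod_cast hj)
  · norm_num

/-- On the centre of the `q`-th window, `a(2^{2^q}) = 2^q` ((2.2) with `i = 0`). [cite: Ri2025, (2.2) l.307–315 (print p.5)] -/
theorem a_centre {q : ℕ} (hq : 1 ≤ q) : a ((2 : ℕ) ^ (2 ^ q) : ℕ) = 2 ^ q := by
  unfold a
  rw [if_pos ⟨q, hq, by push_cast; simp⟩]
  push_cast
  rw [Real.logb_pow, Real.logb_self_eq_one (by norm_num)]
  push_cast
  ring

/-- `b(j) ≥ a(j)/2`: the top term of (3.2) alone. [cite: Ri2025, (3.2) l.526–529 (print p.8)] -/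
theorem b_ge_half_a {j : ℕ} (hj : 1 ≤ j) : a j / 2 ≤ b j := by
  unfold b
  have hmem : j ∈ Icc 1 j := by simp [hj]
  have hle : (2 : ℝ) ^ j * a j ≤ ∑ i ∈ Icc 1 j, (2 : ℝ) ^ i * a i := by
    apply Finset.single_le_sum (f := fun i : ℕ => (2 : ℝ) ^ i * a i) _ hmem
    intro i hi
    have hi1 : (1 : ℤ) ≤ (i : ℤ) := by
      have := (Finset.mem_Icc.mp hi).1
      exact_mod_cast this
    exact mul_nonneg (by positivity) (a_nonneg hi1)
  have hpos : (0 : ℝ) < 2 ^ (j + 1) := by positivity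
  rw [le_div_iff₀ hpos]
  calc a ↑j / 2 * 2 ^ (j + 1) = 2 ^ j * a j := by ring
    _ ≤ _ := hle

/-- `b(j) ≥ 0` ((3.2), nonnegative summands). [cite: Ri2025, (3.2) l.526–529 (print p.8)] -/
theorem b_nonneg (j : ℕ) : 0 ≤ b j := by
  unfold b
  apply div_nonneg _ (by positivity)
  apply Finset.sum_nonneg
  intro i hi
  have hi1 : (1 : ℤ) ≤ (i : ℤ) := by
    have := (Finset.mem_Icc.mp hi).1
    exact_mod_cast this
  exact mul_nonneg (by positivity) (a_nonneg hi1)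

/-- For `2^{L−3} < k ≤ 2^{L−2}` (`L ≥ 3`): `j₀(2k) = L` ((4.3)). [cite: Ri2025, (4.3) l.707–710 (print p.11)] -/
theorem j₀_two_mul {L k : ℕ} (hL : 3 ≤ L) (h1 : 2 ^ (L - 3) < k) (h2 : k ≤ 2 ^ (L - 2)) :
    j₀ (2 * k) = L := by
  unfold j₀
  have hup : Nat.clog 2 (2 * k) ≤ L - 1 := by
    rw [Nat.clog_le_iff_le_pow (by norm_num)]
    have : 2 ^ (L - 1) = 2 * 2 ^ (L - 2) := by
      rw [← Nat.pow_succ']; congr 1; omega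
    rw [this]; omega
  have hlo : L - 2 < Nat.clog 2 (2 * k) := by
    rw [Nat.lt_clog_iff_pow_lt (by norm_num)]
    have : 2 ^ (L - 2) = 2 * 2 ^ (L - 3) := by
      rw [← Nat.pow_succ']; congr 1; omega
    rw [this]; omega
  omega

/-- For `2^{L−3} ≤ k < 2^{L−2}` (`L ≥ 3`): `j₀(2k+1) = L` ((4.3)). [cite: Ri2025, (4.3) l.707–710 (print p.11)] -/
theorem j₀_two_mul_add_one {L k : ℕ} (hL : 3 ≤ L) (h1 : 2 ^ (L - 3) ≤ k) (h2 : k < 2 ^ (L - 2)) :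
    j₀ (2 * k + 1) = L := by
  unfold j₀
  have hup : Nat.clog 2 (2 * k + 1) ≤ L - 1 := by
    rw [Nat.clog_le_iff_le_pow (by norm_num)]
    have : 2 ^ (L - 1) = 2 * 2 ^ (L - 2) := by
      rw [← Nat.pow_succ']; congr 1; omega
    rw [this]; omega
  have hlo : L - 2 < Nat.clog 2 (2 * k + 1) := by
    rw [Nat.lt_clog_iff_pow_lt (by norm_num)]
    have : 2 ^ (L - 2) = 2 * 2 ^ (L - 3) := by
      rw [← Nat.pow_succ']; congr 1; omega
    rw [this]; omega
  omega

/-! ### The witness family -/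

/-- The witness family: `L q = 2^{2^q}`, the centre of the `q`-th window of (2.2). [cite: Ri2025, (2.2) l.307–315 (print p.5)] -/
def L (q : ℕ) : ℕ := 2 ^ (2 ^ q)

/-- The witness family: `n q = 2^{L q − 2}`, so that `⌈log₂ n⌉ + 2 = L q`. [cite: Ri2025, §3 Step 2, l.806 (print p.12)] -/
def n (q : ℕ) : ℕ := 2 ^ (L q - 2)

/-- `L q ≥ 3` for `q ≥ 1`. [cite: Ri2025, (2.2) l.307–315 (print p.5)] -/
theorem three_le_L {q : ℕ} (hq : 1 ≤ q) : 3 ≤ L q := by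
  unfold L
  have h1 : 2 ≤ 2 ^ q := by
    calc 2 = 2 ^ 1 := by norm_num
      _ ≤ 2 ^ q := Nat.pow_le_pow_right (by norm_num) hq
  calc 3 ≤ 2 ^ 2 := by norm_num
    _ ≤ 2 ^ (2 ^ q) := Nat.pow_le_pow_right (by norm_num) h1

/-- `b(L q) ≥ 2^q / 2` (top term of (3.2) at the window centre). [cite: Ri2025, (3.2) l.526–529 (print p.8)] -/
theorem bL_ge {q : ℕ} (hq : 1 ≤ q) : (2 : ℝ) ^ q / 2 ≤ b (L q) := by
  have h := b_ge_half_a (j := L q) (by have := three_le_L hq; omega)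
  have hc := a_centre hq
  unfold L at h ⊢
  rw [hc] at h
  exact h

/-- `q < n q` (so the family exhausts every threshold `n₀`). [cite: Ri2025, §3 Step 2, l.830–839 (print p.13)] -/
theorem q_lt_n (q : ℕ) (hq : 1 ≤ q) : q < n q := by
  unfold n
  have h3 := three_le_L hq
  have hq' : q < 2 ^ q := Nat.lt_two_pow_self
  have hL' : 2 ^ q < L q := by
    unfold L
    exact Nat.pow_lt_pow_right (by norm_num) hq'
  have : L q - 2 < 2 ^ (L q - 2) := Nat.lt_two_pow_self
  omega

/-- Master lower bound for the `2k`-sum: `Σ_{k ≤ n q} b(j₀(2k)) ≥ 2^q/4 · n q`. [cite: Ri2025, §3 Step 2, l.830–833 (print p.13)] -/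
theorem sum_even_ge {q : ℕ} (hq : 1 ≤ q) :
    (2 : ℝ) ^ q / 4 * (n q) ≤ ∑ k ∈ Icc 1 (n q), b (j₀ (2 * k)) := by
  have h3 := three_le_L hq
  set T : Finset ℕ := Ioc (2 ^ (L q - 3)) (2 ^ (L q - 2)) with hT
  have hsub : T ⊆ Icc 1 (n q) := by
    intro k hk
    rw [hT, Finset.mem_Ioc] at hk
    rw [Finset.mem_Icc]; unfold n
    constructor
    · have : 1 ≤ 2 ^ (L q - 3) := Nat.one_le_two_pow
      omega
    · exact hk.2
  have hconst : ∀ k ∈ T, b (j₀ (2 * k)) = b (L q) := by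
    intro k hk
    rw [hT, Finset.mem_Ioc] at hk
    rw [j₀_two_mul h3 hk.1 hk.2]
  have hcard : T.card = 2 ^ (L q - 3) := by
    rw [hT, Nat.card_Ioc]
    have : 2 ^ (L q - 2) = 2 * 2 ^ (L q - 3) := by
      rw [← Nat.pow_succ']; congr 1; omega
    omega
  calc (2 : ℝ) ^ q / 4 * (n q) = (2 ^ (L q - 3) : ℕ) * ((2 : ℝ) ^ q / 2) := by
          unfold n
          have : L q - 2 = (L q - 3) + 1 := by omega
          rw [this]; push_cast; ring
    _ ≤ (T.card : ℝ) * b (L q) := by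
          rw [hcard]
          exact mul_le_mul_of_nonneg_left (bL_ge hq) (by positivity)
    _ = ∑ k ∈ T, b (L q) := by rw [Finset.sum_const, nsmul_eq_mul]
    _ = ∑ k ∈ T, b (j₀ (2 * k)) := by
          apply Finset.sum_congr rfl; intro k hk; rw [hconst k hk]
    _ ≤ ∑ k ∈ Icc 1 (n q), b (j₀ (2 * k)) :=
          Finset.sum_le_sum_of_subset_of_nonneg hsub (fun k _ _ => b_nonneg _)

/-- Master lower bound for the `(2k+1)`-sum: `Σ_{k ≤ n q} b(j₀(2k+1)) ≥ 2^q/4 · n q`. [cite: Ri2025, §3 Step 2, l.834–839 (print p.13)] -/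
theorem sum_odd_ge {q : ℕ} (hq : 1 ≤ q) :
    (2 : ℝ) ^ q / 4 * (n q) ≤ ∑ k ∈ Icc 1 (n q), b (j₀ (2 * k + 1)) := by
  have h3 := three_le_L hq
  set T : Finset ℕ := Ico (2 ^ (L q - 3)) (2 ^ (L q - 2)) with hT
  have hsub : T ⊆ Icc 1 (n q) := by
    intro k hk
    rw [hT, Finset.mem_Ico] at hk
    rw [Finset.mem_Icc]; unfold n
    constructor
    · have : 1 ≤ 2 ^ (L q - 3) := Nat.one_le_two_pow
      omega
    · exact hk.2.le
  have hconst : ∀ k ∈ T, b (j₀ (2 * k + 1)) = b (L q) := by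
    intro k hk
    rw [hT, Finset.mem_Ico] at hk
    rw [j₀_two_mul_add_one h3 hk.1 hk.2]
  have hcard : T.card = 2 ^ (L q - 3) := by
    rw [hT, Nat.card_Ico]
    have : 2 ^ (L q - 2) = 2 * 2 ^ (L q - 3) := by
      rw [← Nat.pow_succ']; congr 1; omega
    omega
  calc (2 : ℝ) ^ q / 4 * (n q) = (2 ^ (L q - 3) : ℕ) * ((2 : ℝ) ^ q / 2) := by
          unfold n
          have : L q - 2 = (L q - 3) + 1 := by omega
          rw [this]; push_cast; ring
    _ ≤ (T.card : ℝ) * b (L q) := by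
          rw [hcard]
          exact mul_le_mul_of_nonneg_left (bL_ge hq) (by positivity)
    _ = ∑ k ∈ T, b (L q) := by rw [Finset.sum_const, nsmul_eq_mul]
    _ = ∑ k ∈ T, b (j₀ (2 * k + 1)) := by
          apply Finset.sum_congr rfl; intro k hk; rw [hconst k hk]
    _ ≤ ∑ k ∈ Icc 1 (n q), b (j₀ (2 * k + 1)) :=
          Finset.sum_le_sum_of_subset_of_nonneg hsub (fun k _ _ => b_nonneg _)

/-! ### Refutations -/

/-- The «generic constant» reading of the averaging bound (`∃ C, n₀`, referee R#b) is false: the ratio `Σ_{k≤n} b(j₀(2k)) / n` is unbounded along `n = 2^{2^{2^q} − 2}`. [cite: Ri2025, §3 Step 2, l.830–839 (print p.13)] -/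
theorem not_StepAvgC : ¬ StepAvgC := by
  rintro ⟨C, n₀, h⟩
  -- choose q with n q ≥ n₀ and 2^q/4 > C
  obtain ⟨m, hm⟩ := exists_nat_gt (4 * C)
  set q : ℕ := max (n₀ + 1) (m + 1) with hq_def
  have hq1 : 1 ≤ q := by omega
  have hqn : n₀ ≤ n q := by
    have := q_lt_n q hq1
    omega
  have hC : C < (2 : ℝ) ^ q / 4 := by
    have hmq : (m : ℝ) + 1 ≤ q := by
      have : m + 1 ≤ q := le_max_right _ _
      exact_mod_cast this
    have h2 : (q : ℝ) < (2 : ℝ) ^ q := by exact_mod_cast (Nat.lt_two_pow_self (n := q))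
    linarith
  have hnpos : (0 : ℝ) < n q := by
    have := q_lt_n q hq1
    exact_mod_cast (show 0 < n q by omega)
  have := (h (n q) hqn).1
  have hge := sum_even_ge hq1
  have : (2 : ℝ) ^ q / 4 * (n q) ≤ C * (n q) := le_trans hge this
  have := lt_of_lt_of_le (mul_lt_mul_of_pos_right hC hnpos) (le_refl _)
  linarith

/-- THE AVERAGING BOUND as printed (constant `3`, l.830–839) is false. [cite: Ri2025, §3 Step 2, l.830–839 (print p.13)] -/
theorem not_StepAvg : ¬ StepAvg := by
  rintro ⟨n₀, h⟩
  exact not_StepAvgC ⟨3, n₀, h⟩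


/-- The odd half "in the same way" (l.834–839) is false, by the same family.
[cite: Ri2025, §3 Step 2, l.834–839 (print p.13)] -/
theorem not_StepAvgOdd : ¬ StepAvgOdd := by
  rintro ⟨n₀, h⟩
  set q : ℕ := n₀ + 4 with hq_def
  have hq1 : 1 ≤ q := by omega
  have hqn : n₀ ≤ n q := by have := q_lt_n q hq1; omega
  have hnpos : (0 : ℝ) < n q := by
    have := q_lt_n q hq1
    exact_mod_cast (show 0 < n q by omega)
  have h16 : (16 : ℝ) ≤ (2 : ℝ) ^ q := by
    have : (2 : ℝ) ^ 4 ≤ 2 ^ q := pow_le_pow_right₀ (by norm_num) (by omega)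
    norm_num at this; exact this
  have hge := sum_odd_ge hq1
  have hle := h (n q) hqn
  nlinarith

end Summit.NavierStokesRegularity.NavierStokesRegularity.Theorems.Ri2025

end
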